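import Mathlib
import Summits.NavierStokesRegularity.NavierStokesRegularity.Theorems.SymmetryModuliCountFarPastLedgerSliceDecomp
import Summits.NavierStokesRegularity.NavierStokesRegularity.Theorems.SymmetryModuliCountFarPastLedgerSliceConsistency
import HarnessLib

/-!
# Slice pressure, the canonical affine mode (crux `FarPastLedger`, line `uloc-gronwall-transplant`)

Helper file for the lead's stub `stub_fplSlicePressure` of crux stmt-NavierStokesRegularity-14060
(`SymmetryModuliCount.FarPastLedger`). Combining the local identity (`fpl_slice_identity`) with
the consistency of the splitting (`fpl_slice_consistency`): for EVERY adapted partition `(η, ζ)`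
at `(c, R)` whose ball `B(c, 2R)` contains the origin,

  `Dq(x) - D(p̃[ηw])(x) + ∫ D³Γ∞(x-y)(·, ζw, ζw) dy = A`   for all `x ∈ B(c, 2R)`,

where `A` is the same covector computed from a fixed partition at `(0, 1)`
(`fpl_slice_eq_canonical`). Also: the far weight of `ζ w` is dominated by that of `w` off
`B(x₀, 3R)` (`fpl_far_weight_le`).
-/

noncomputable section

open MeasureTheory Set Filter Metric Topology
open scoped ContDiff Laplacian

set_option linter.dupNamespace false -- nested layout Summit.<S>.<Sub>, Sub = S (D-0017)

namespace Summit.NavierStokesRegularity.NavierStokesRegularity.Theorems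

open Literature.Analysis.FluidPDE

-- nested operator types `E →L[ℝ] E →L[ℝ] E →L[ℝ] ℝ`
set_option maxSynthPendingDepth 3

/-- **THE CANONICAL AFFINE MODE.** With the data of `fpl_slice_identity` and a fixed adapted
partition `(η₁, ζ₁)` at `(0, 1)`, every adapted partition `(η, ζ)` at `(c, R)`, `R ≥ 1`, with
`0 ∈ B(c, 2R)` satisfies, for all `x ∈ B(c, 2R)`,
`Dq(x) - D(p̃[ηw])(x) + ∫ D³Γ∞_R(x-y)(·,ζw,ζw) = Dq(0) - D(p̃[η₁w])(0) + ∫ D³Γ∞_1(0-y)(·,ζ₁w,ζ₁w)`. -/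
theorem fpl_slice_eq_canonical
    {w : EuclideanSpace ℝ (Fin 3) → EuclideanSpace ℝ (Fin 3)} (hw : ContDiff ℝ ∞ w)
    (hdiv : VectorCalculus.IsDivFree w) {M : ℝ} (hM : ∀ y, ‖w y‖ ≤ M)
    {q : EuclideanSpace ℝ (Fin 3) → ℝ} (hq : ContDiff ℝ ∞ q) {L : ℝ} (hL : ∀ x, ‖fderiv ℝ q x‖ ≤ L)
    (hΔq : ∀ x, (Δ q) x = -VectorCalculus.divergence (convect w w) x)
    {η₁ ζ₁ : EuclideanSpace ℝ (Fin 3) → ℝ} (hη₁ : ContDiff ℝ ∞ η₁) (hζ₁ : ContDiff ℝ ∞ ζ₁)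
    (h1₁ : ∀ y, η₁ y ^ 2 + ζ₁ y ^ 2 = 1)
    (hη₁0 : ∀ y ∉ ball (0 : EuclideanSpace ℝ (Fin 3)) (4 * 1), η₁ y = 0)
    (hζ₁0 : ∀ y ∈ ball (0 : EuclideanSpace ℝ (Fin 3)) (3 * 1), ζ₁ y = 0)
    {c : EuclideanSpace ℝ (Fin 3)} {R : ℝ} (hR : 1 ≤ R)
    {η ζ : EuclideanSpace ℝ (Fin 3) → ℝ} (hη : ContDiff ℝ ∞ η) (hζ : ContDiff ℝ ∞ ζ)
    (h1 : ∀ y, η y ^ 2 + ζ y ^ 2 = 1) (hη0 : ∀ y ∉ ball c (4 * R), η y = 0)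
    (hζ0 : ∀ y ∈ ball c (3 * R), ζ y = 0) (hc0 : (0 : EuclideanSpace ℝ (Fin 3)) ∈ ball c (2 * R))
    {x : EuclideanSpace ℝ (Fin 3)} (hx : x ∈ ball c (2 * R)) :
    fderiv ℝ q x - fderiv ℝ (normalisedPressure fun y => η y • w y) x +
        ∫ y, (evalDiag (ζ y • w y)).comp (fderiv ℝ (fderiv ℝ (fderiv ℝ (newtonFar (R / 2) R))) (x - y)) =
      fderiv ℝ q 0 - fderiv ℝ (normalisedPressure fun y => η₁ y • w y) 0 +
        ∫ y, (evalDiag (ζ₁ y • w y)).comp (fderiv ℝ (fderiv ℝ (fderiv ℝ (newtonFar (1 / 2) 1))) (0 - y)) := by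
  -- the identity for `(c, R)` at `x` and at `0`
  have hx' := fpl_slice_identity hw hdiv hM hq hL hΔq hR hη hζ h1 hη0 hζ0 hx
  have h0' := fpl_slice_identity hw hdiv hM hq hL hΔq hR hη hζ h1 hη0 hζ0 hc0
  -- consistency at `0 ∈ B(c, 2R) ∩ B(0, 2)`
  have h00 : (0 : EuclideanSpace ℝ (Fin 3)) ∈ ball (0 : EuclideanSpace ℝ (Fin 3)) (2 * 1) :=
    mem_ball_self (by norm_num)
  have hcons := fpl_slice_consistency hw hM hR le_rfl hη hζ hη₁ hζ₁ h1 h1₁ hη0 hζ0 hη₁0 hζ₁0 hc0 h00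
  rw [hx', ← h0']
  -- `Dq 0 - DN 0 + G 0 = Dq 0 - (DN 0 - G 0)` and the bracket is canonical
  have e : ∀ (a b g : EuclideanSpace ℝ (Fin 3) →L[ℝ] ℝ), a - b + g = a - (b - g) := fun a b g => by abel
  rw [e, e, hcons]

/-! ### The far weight of `ζ w` -/

/-- Integrability of `‖w‖² ‖y - x₀‖⁻⁴` off `B(x₀, 3R)` for a bounded continuous `w`, `R ≥ 1`. -/
theorem fpl_integrableOn_far_weight {w : EuclideanSpace ℝ (Fin 3) → EuclideanSpace ℝ (Fin 3)}
    (hw : Continuous w) {M : ℝ} (hM : ∀ y, ‖w y‖ ≤ M) (x₀ : EuclideanSpace ℝ (Fin 3)) {R : ℝ}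
    (hR : 1 ≤ R) :
    IntegrableOn (fun y => ‖w y‖ ^ 2 / ‖y - x₀‖ ^ 4) (ball x₀ (3 * R))ᶜ volume := by
  set u : EuclideanSpace ℝ (Fin 3) → EuclideanSpace ℝ (Fin 3) := (ball x₀ (3 * R))ᶜ.indicator w with hu
  have hum : AEStronglyMeasurable u volume :=
    (hw.aestronglyMeasurable).indicator (measurableSet_ball.compl)
  have hM0 : 0 ≤ M := (norm_nonneg _).trans (hM x₀)
  have huM : ∀ y, ‖u y‖ ≤ M := fun y => by
    rw [hu]
    by_cases hy : y ∈ (ball x₀ (3 * R))ᶜ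
    · rw [indicator_of_mem hy]; exact hM y
    · rw [indicator_of_notMem hy, norm_zero]; exact hM0
  have hu0 : ∀ y ∈ ball x₀ (3 * R), u y = 0 := fun y hy => by
    rw [hu]
    exact indicator_of_notMem (fun h : y ∈ (ball x₀ (3 * R))ᶜ => h hy) _
  have hint := fpl_integrable_far_weight hum huM hR hu0
  refine (hint.integrableOn (s := (ball x₀ (3 * R))ᶜ)).congr_fun (fun y hy => ?_)
    (measurableSet_ball.compl)
  simp only [hu, indicator_of_mem hy]

/-- **The far weight of `ζ w` is dominated by that of `w` off `B(x₀, 3R)`**: for `|ζ| ≤ 1`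
vanishing on `B(x₀, 3R)`, `R ≥ 1`, `w` bounded continuous,
`∫ ‖ζ w‖² ‖y - x₀‖⁻⁴ ≤ ∫_{|y - x₀| ≥ 3R} ‖w‖² ‖y - x₀‖⁻⁴`. -/
theorem fpl_far_weight_le {w : EuclideanSpace ℝ (Fin 3) → EuclideanSpace ℝ (Fin 3)}
    (hw : Continuous w) {M : ℝ} (hM : ∀ y, ‖w y‖ ≤ M) {ζ : EuclideanSpace ℝ (Fin 3) → ℝ}
    (hζc : Continuous ζ) (hζ1 : ∀ y, |ζ y| ≤ 1) (x₀ : EuclideanSpace ℝ (Fin 3)) {R : ℝ} (hR : 1 ≤ R)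
    (hζ0 : ∀ y ∈ ball x₀ (3 * R), ζ y = 0) :
    ∫ y, ‖ζ y • w y‖ ^ 2 / ‖y - x₀‖ ^ 4 ≤ ∫ y in (ball x₀ (3 * R))ᶜ, ‖w y‖ ^ 2 / ‖y - x₀‖ ^ 4 := by
  have hIw := fpl_integrableOn_far_weight hw hM x₀ hR
  -- the integrand of the left-hand side vanishes on the ball
  have e1 : ∫ y, ‖ζ y • w y‖ ^ 2 / ‖y - x₀‖ ^ 4 =
      ∫ y in (ball x₀ (3 * R))ᶜ, ‖ζ y • w y‖ ^ 2 / ‖y - x₀‖ ^ 4 := by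
    refine (setIntegral_eq_integral_of_forall_compl_eq_zero (fun y hy => ?_)).symm
    have hy' : y ∈ ball x₀ (3 * R) := Set.notMem_compl_iff.1 hy
    rw [hζ0 y hy', zero_smul, norm_zero, zero_pow two_ne_zero, zero_div]
  rw [e1]
  -- pointwise comparison on the complement
  have hpt : ∀ y, ‖ζ y • w y‖ ^ 2 / ‖y - x₀‖ ^ 4 ≤ ‖w y‖ ^ 2 / ‖y - x₀‖ ^ 4 := fun y => by
    refine div_le_div_of_nonneg_right ?_ (by positivity)
    rw [norm_smul, mul_pow, Real.norm_eq_abs]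
    have h1 : |ζ y| ^ 2 ≤ 1 := pow_le_one₀ (abs_nonneg _) (hζ1 y)
    nlinarith [sq_nonneg (‖w y‖)]
  have hIζ : IntegrableOn (fun y => ‖ζ y • w y‖ ^ 2 / ‖y - x₀‖ ^ 4) (ball x₀ (3 * R))ᶜ volume := by
    refine Integrable.mono' hIw ?_ (Eventually.of_forall fun y => ?_)
    · have h1 : AEMeasurable (fun y => ‖ζ y • w y‖ ^ 2) (volume.restrict (ball x₀ (3 * R))ᶜ) :=
        ((hζc.smul hw).norm.pow 2).aemeasurable
      have h2 : Measurable (fun y : EuclideanSpace ℝ (Fin 3) => ‖y - x₀‖ ^ 4) := by fun_prop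
      exact (h1.div h2.aemeasurable).aestronglyMeasurable
    · rw [Real.norm_eq_abs, abs_of_nonneg (by positivity)]
      exact hpt y
  exact setIntegral_mono_on hIζ hIw (measurableSet_ball.compl) (fun y _ => hpt y)

/-- Registered form (sub-goal `fpl_sliceCanonical_main` of crux stmt-NavierStokesRegularity-14060):
the canonical affine mode. -/
theorem fpl_sliceCanonical_main :
    ∀ (w : EuclideanSpace ℝ (Fin 3) → EuclideanSpace ℝ (Fin 3)), ContDiff ℝ (⊤ : ℕ∞) w →
    Literature.Analysis.FluidPDE.VectorCalculus.IsDivFree w → ∀ (M : ℝ), (∀ y, ‖w y‖ ≤ M) →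
    ∀ (q : EuclideanSpace ℝ (Fin 3) → ℝ), ContDiff ℝ (⊤ : ℕ∞) q → ∀ (L : ℝ), (∀ x, ‖fderiv ℝ q x‖ ≤ L) →
    (∀ x, Laplacian.laplacian q x =
      -Literature.Analysis.FluidPDE.VectorCalculus.divergence
        (Literature.Analysis.FluidPDE.convect w w) x) →
    ∀ (η₁ ζ₁ : EuclideanSpace ℝ (Fin 3) → ℝ), ContDiff ℝ (⊤ : ℕ∞) η₁ → ContDiff ℝ (⊤ : ℕ∞) ζ₁ →
    (∀ y, η₁ y ^ 2 + ζ₁ y ^ 2 = 1) →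
    (∀ y ∉ Metric.ball (0 : EuclideanSpace ℝ (Fin 3)) (4 * 1), η₁ y = 0) →
    (∀ y ∈ Metric.ball (0 : EuclideanSpace ℝ (Fin 3)) (3 * 1), ζ₁ y = 0) →
    ∀ (c : EuclideanSpace ℝ (Fin 3)) (R : ℝ), 1 ≤ R →
    ∀ (η ζ : EuclideanSpace ℝ (Fin 3) → ℝ), ContDiff ℝ (⊤ : ℕ∞) η → ContDiff ℝ (⊤ : ℕ∞) ζ →
    (∀ y, η y ^ 2 + ζ y ^ 2 = 1) → (∀ y ∉ Metric.ball c (4 * R), η y = 0) →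
    (∀ y ∈ Metric.ball c (3 * R), ζ y = 0) → (0 : EuclideanSpace ℝ (Fin 3)) ∈ Metric.ball c (2 * R) →
    ∀ x ∈ Metric.ball c (2 * R),
    fderiv ℝ q x - fderiv ℝ (Literature.Analysis.FluidPDE.normalisedPressure fun y => η y • w y) x +
        ∫ y, (Literature.Analysis.FluidPDE.evalDiag (ζ y • w y)).comp
          (fderiv ℝ (fderiv ℝ (fderiv ℝ (Literature.Analysis.FluidPDE.newtonFar (R / 2) R))) (x - y)) =
      fderiv ℝ q 0 - fderiv ℝ (Literature.Analysis.FluidPDE.normalisedPressure fun y => η₁ y • w y) 0 +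
        ∫ y, (Literature.Analysis.FluidPDE.evalDiag (ζ₁ y • w y)).comp
          (fderiv ℝ (fderiv ℝ (fderiv ℝ (Literature.Analysis.FluidPDE.newtonFar (1 / 2) 1))) (0 - y)) :=
  fun _ hw hdiv _ hM _ hq _ hL hΔq _ _ hη₁ hζ₁ h1₁ hη₁0 hζ₁0 _ _ hR _ _ hη hζ h1 hη0 hζ0 hc0 _ hx =>
    fpl_slice_eq_canonical hw hdiv hM hq hL hΔq hη₁ hζ₁ h1₁ hη₁0 hζ₁0 hR hη hζ h1 hη0 hζ0 hc0 hx

end Summit.NavierStokesRegularity.NavierStokesRegularity.Theorems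

end
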